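import Literature.MathematicalPhysics.QuantumFieldTheory.ConformalBootstrap3D.MeanFieldSources
import Literature.MathematicalPhysics.QuantumFieldTheory.ConformalBootstrap3D.SingleCorrelatorNonVacuity
import Mathlib.Analysis.Analytic.Binomial
import Mathlib.Tactic
import HarnessLib

/-!
# The conformal block decomposition of generalised free (mean-field) four-point functions in `d = 3`

For a generalised free scalar `φ` of dimension `Δ_φ = p` in three dimensions,
`⟨φφφφ⟩ = (x₁₂² x₃₄²)^{-p} 𝒢(u,v)`, `𝒢 = 1 + u^p + (u/v)^p`, and `φ × φ` contains the double-twist operators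
`[φφ]_{n,ℓ}` of dimension `2p + 2n + ℓ` and even spin `ℓ`, with squared OPE coefficients `2 P_{n,ℓ}(p)`
(`P = mftCoeff`, Fitzpatrick–Kaplan 2012 §2.2 in the tree's block normalisation; originally
Heemskerk–Penedones–Polchinski–Sully 2009). This file PROVES, for every real `p > 1/2` (the line strictly above
the unitarity bound, where every block of the expansion is a typed block of the `σ–ε` system), the
decomposition as a `HasSum` identity on the open square `z, z̄ ∈ (0,1)`:

  `𝒢(z,z̄) - 1 = Σ_{n, m ≥ 0} 2 P_{n,2m}(p) g_{2p+2n+2m, 2m}(z,z̄)`   (`hasSum_gff_blocks`),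

from the formal identities of `MeanFieldSources` (Casimir-pair closure) in three steps:

1. (`𝒫`-frame → monomials, §§1–2, finite algebra) `gg_conversion`: `Σ_j gg(p; N, j) e_{N,j}(i,k) = (p)_i (p)_k/(i! k!)`
   (`N = i + k`; the `𝒫`-array `gg(p)` IS `(1-z)^{-p}(1-z̄)^{-p}` in the monomial basis `legendreArrDeg` of
   Hogervorst–Rychkov 2013 §3 (3.4)–(3.6)), by a Zeilberger recursion in `i` (`mftConvTerm_step`, certificate
   `mftConvCert`); `hrMonomialCoeff_shift` (the block `(2p+2n+ℓ,ℓ)` shifted by `(z z̄)^n` read off `blockArr`); and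
   the **degree identity** `mft_degree_identity`:
   `Σ_{n,ℓ ≤ N} (1+(-1)^ℓ) P_{n,ℓ}(p) [n ≤ i,k] k^{(2p+2n+ℓ,ℓ)}_{(i-n,k-n)} = δ_{N,0} + (p)_i (p)_k/(i! k!)` — the coefficient of
   `(z z̄)^p z^i z̄^k` on both sides.
2. (analysis, §§3–5) the binomial series `Σ_i (p)_i/i! x^i = (1-x)^{-p}` (Mathlib) and Tonelli on the non-negative family
   `(1+(-1)^ℓ) P_{n,ℓ} [n ≤ i,k] k_{(i-n,k-n)} z^i z̄^k` (exactly the architecture of `FreeScalarBlockDecomposition`, the case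
   `p = 1/2`, `n = 0`), then `× (z z̄)^p` and re-indexing `ℓ = 2m`.
3. (the datum, §6) `gffData p` and its axioms.

Consequences (`gffData`, `gffData_satisfiesSigmaAxioms`): **every point `(Δ_σ, Δ_ε) = (p, 2p)`, `p > 1/2`, of
the generalised-free line carries a datum satisfying the single-correlator axioms `SatisfiesSigmaAxioms`**
(typed blocks, unitarity, even spins, sum rule 1, and the gap "scalars below `3` are `ε`": the scalars of
`φ × φ` are `2p + 2n`, and `2p + 2n ≥ 2p + 2 > 3` for `n ≥ 1`). Hence no σ-excluded box, and no assembly of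
single-correlator certificates, can exclude any point of this line (`SigmaBoxExcluded.gff_not_mem`,
`SigmaIsingEnclosure.gff_mem`): the per-column non-vacuity of the single-correlator hypothesis class, for every
column `Δ_σ = p > 1/2`.

References: A. L. Fitzpatrick, J. Kaplan, JHEP 10 (2012) 032, §2.2, the closed form for $(\bar c^{12}_{n,\ell})^2$ [cite: FitzpatrickKaplan2012, §2.2];
I. Heemskerk, J. Penedones, J. Polchinski, J. Sully, JHEP 10 (2009) 079, §2
[cite: HeemskerkPenedonesPolchinskiSully2009, §2]; M. Hogervorst, S. Rychkov, JHEP 06 (2013) 106, §2.1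
eq. (2.16) [cite: HogervorstRychkov2013, §2.1 eq. (2.16)]; S. El-Showk et al., Phys. Rev. D 86 (2012) 025022, §5
[cite: ElShowkEtAl2012, §5]. Mathlib: `Real.one_div_one_sub_rpow_hasFPowerSeriesOnBall_zero`,
`summable_prod_of_nonneg`, `HasSum.prod_fiberwise`, `Function.Injective.hasSum_iff`.
-/

namespace Literature.MathematicalPhysics.QuantumFieldTheory.ConformalBootstrap3D

open Finset Set Filter Topology


/-! ### 1. The conversion sum `Σ_t gg(p; N, N-2t) λ_{i-t} λ_{k-t}` -/

/-- `(3/2)_M = (1/2)_M (2M+1)`. [folklore] -/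
theorem poch_threeHalves (M : ℕ) : poch (3 / 2) M = poch (1 / 2) M * (2 * M + 1) := by
  have h := poch_succ_left (1 / 2 : ℝ) M
  rw [poch_succ] at h
  norm_num at h
  linarith

/-- The `t`-th term of the conversion sum at `(i, k)`: `gg(p; i+k, i+k-2t) λ_{i-t} λ_{k-t}` for
`t ≤ min(i,k)`, else `0`. [folklore] -/
noncomputable def mftConvTerm (p : ℝ) (i k t : ℕ) : ℝ :=
  if t ≤ i ∧ t ≤ k then
    poch (p - 1 / 2) t * poch p (i + k - t) * (2 * ((i : ℝ) + k) - 4 * t + 1) /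
        ((t.factorial : ℝ) * poch (3 / 2) (i + k - t)) * (legendreLam (i - t) * legendreLam (k - t))
  else 0

/-- The Zeilberger certificate of the recursion in `i`:
`G(i,t) = -t (2k-2t+1)/(2(i+1+k)-4t+1) · mftConvTerm p (i+1) k t`. [folklore] -/
noncomputable def mftConvCert (p : ℝ) (i k t : ℕ) : ℝ :=
  -((t : ℝ) * (2 * k - 2 * t + 1) / (2 * ((i : ℝ) + 1 + k) - 4 * t + 1)) * mftConvTerm p (i + 1) k t

/-- Evaluation of `mftConvTerm` on its support, in shifted variables `i = t + m₁`, `k = t + m₂`. [folklore] -/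
theorem mftConvTerm_of_eq (p : ℝ) {i k t : ℕ} (m₁ m₂ : ℕ) (hi : i = t + m₁) (hk : k = t + m₂) :
    mftConvTerm p i k t = poch (p - 1 / 2) t * poch p (t + m₁ + m₂) * (2 * ((m₁ : ℝ) + m₂) + 1) /
        ((t.factorial : ℝ) * poch (3 / 2) (t + m₁ + m₂)) * (legendreLam m₁ * legendreLam m₂) := by
  subst hi hk
  unfold mftConvTerm
  have e : t + m₁ + (t + m₂) - t = t + m₁ + m₂ := by omega
  rw [if_pos ⟨by omega, by omega⟩, e]
  simp only [Nat.add_sub_cancel_left]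
  push_cast
  ring

/-- `mftConvTerm` vanishes for `t > i`. [folklore] -/
theorem mftConvTerm_of_lt_left (p : ℝ) {i k t : ℕ} (h : i < t) : mftConvTerm p i k t = 0 := by
  unfold mftConvTerm; rw [if_neg (by omega)]

/-- `mftConvTerm` vanishes for `t > k`. [folklore] -/
theorem mftConvTerm_of_lt_right (p : ℝ) {i k t : ℕ} (h : k < t) : mftConvTerm p i k t = 0 := by
  unfold mftConvTerm; rw [if_neg (by omega)]

/-- `mftConvCert p i k 0 = 0`. [folklore] -/
theorem mftConvCert_zero (p : ℝ) (i k : ℕ) : mftConvCert p i k 0 = 0 := by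
  simp [mftConvCert]

/-- `mftConvCert` vanishes for `t > k`. [folklore] -/
theorem mftConvCert_of_lt_right (p : ℝ) {i k t : ℕ} (h : k < t) : mftConvCert p i k t = 0 := by
  unfold mftConvCert; rw [mftConvTerm_of_lt_right p h, mul_zero]

/-- `mftConvCert` vanishes for `t > i + 1`. [folklore] -/
theorem mftConvCert_of_lt_left (p : ℝ) {i k t : ℕ} (h : i + 1 < t) : mftConvCert p i k t = 0 := by
  unfold mftConvCert; rw [mftConvTerm_of_lt_left p h, mul_zero]

/-- The three live terms of the generic Zeilberger step, over the common atoms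
`a = (p-1/2)_t`, `B = (p)_{t+m₁+m₂+1}`, `f = t!`, `G = (3/2)_{t+m₁+m₂+1}`, `L₁ = λ_{m₁}`, `L₂ = λ_{m₂}`:
the term `T(i,t)` (`i = t + m₁`, `k = t + m₂ + 1`). [folklore] -/
theorem mftConvTerm_gen₀ (p : ℝ) (t m₁ m₂ : ℕ) :
    mftConvTerm p (t + m₁) (t + (m₂ + 1)) t =
      poch (p - 1 / 2) t * poch p (t + m₁ + m₂ + 1) * (2 * ((m₁ : ℝ) + m₂ + 1) + 1) /
        ((t.factorial : ℝ) * poch (3 / 2) (t + m₁ + m₂ + 1)) *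
        (legendreLam m₁ * (legendreLam m₂ * (2 * (m₂ : ℝ) + 1) / (2 * (m₂ : ℝ) + 2))) := by
  rw [mftConvTerm_of_eq p (i := t + m₁) (k := t + (m₂ + 1)) (t := t) m₁ (m₂ + 1) rfl rfl,
    show t + m₁ + (m₂ + 1) = t + m₁ + m₂ + 1 by omega, legendreLam_succ m₂]
  push_cast
  ring

/-- The term `T(i+1,t)` over the same atoms. [folklore] -/
theorem mftConvTerm_gen₁ (p : ℝ) (t m₁ m₂ : ℕ) :
    mftConvTerm p (t + m₁ + 1) (t + (m₂ + 1)) t =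
      poch (p - 1 / 2) t * (poch p (t + m₁ + m₂ + 1) * (p + ((t : ℝ) + m₁ + m₂ + 1))) *
          (2 * ((m₁ : ℝ) + m₂ + 2) + 1) /
        ((t.factorial : ℝ) * (poch (3 / 2) (t + m₁ + m₂ + 1) * (3 / 2 + ((t : ℝ) + m₁ + m₂ + 1)))) *
        ((legendreLam m₁ * (2 * (m₁ : ℝ) + 1) / (2 * (m₁ : ℝ) + 2)) *
          (legendreLam m₂ * (2 * (m₂ : ℝ) + 1) / (2 * (m₂ : ℝ) + 2))) := by
  rw [mftConvTerm_of_eq p (i := t + m₁ + 1) (k := t + (m₂ + 1)) (t := t) (m₁ + 1) (m₂ + 1) (by omega) rfl,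
    show t + (m₁ + 1) + (m₂ + 1) = t + m₁ + m₂ + 1 + 1 by omega, poch_succ p (t + m₁ + m₂ + 1),
    poch_succ (3 / 2 : ℝ) (t + m₁ + m₂ + 1), legendreLam_succ m₁, legendreLam_succ m₂]
  push_cast
  ring

/-- The term `T(i+1,t+1)` over the same atoms. [folklore] -/
theorem mftConvTerm_gen₂ (p : ℝ) (t m₁ m₂ : ℕ) :
    mftConvTerm p (t + m₁ + 1) (t + (m₂ + 1)) (t + 1) =
      poch (p - 1 / 2) t * (p - 1 / 2 + t) * poch p (t + m₁ + m₂ + 1) * (2 * ((m₁ : ℝ) + m₂) + 1) /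
        ((((t : ℝ) + 1) * (t.factorial : ℝ)) * poch (3 / 2) (t + m₁ + m₂ + 1)) *
        (legendreLam m₁ * legendreLam m₂) := by
  rw [mftConvTerm_of_eq p (i := t + m₁ + 1) (k := t + (m₂ + 1)) (t := t + 1) m₁ m₂ (by omega) (by omega),
    show t + 1 + m₁ + m₂ = t + m₁ + m₂ + 1 by omega, poch_succ (p - 1 / 2) t, Nat.factorial_succ]
  push_cast
  ring

/-- The two live terms of the boundary step `t = k ≤ i` (`i = t + m₁`): `T(i,t)` … [folklore] -/
theorem mftConvTerm_bdry₀ (p : ℝ) (t m₁ : ℕ) :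
    mftConvTerm p (t + m₁) t t =
      poch (p - 1 / 2) t * poch p (t + m₁) * (2 * (m₁ : ℝ) + 1) /
        ((t.factorial : ℝ) * poch (3 / 2) (t + m₁)) * legendreLam m₁ := by
  rw [mftConvTerm_of_eq p (i := t + m₁) (k := t) (t := t) m₁ 0 rfl (by omega), legendreLam_zero]
  simp only [add_zero, Nat.cast_zero, mul_one]

/-- … and `T(i+1,t)`. [folklore] -/
theorem mftConvTerm_bdry₁ (p : ℝ) (t m₁ : ℕ) :
    mftConvTerm p (t + m₁ + 1) t t =
      poch (p - 1 / 2) t * (poch p (t + m₁) * (p + ((t : ℝ) + m₁))) * (2 * ((m₁ : ℝ) + 1) + 1) /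
        ((t.factorial : ℝ) * (poch (3 / 2) (t + m₁) * (3 / 2 + ((t : ℝ) + m₁)))) *
        (legendreLam m₁ * (2 * (m₁ : ℝ) + 1) / (2 * (m₁ : ℝ) + 2)) := by
  rw [mftConvTerm_of_eq p (i := t + m₁ + 1) (k := t) (t := t) (m₁ + 1) 0 (by omega) (by omega),
    legendreLam_zero, show t + (m₁ + 1) + 0 = t + m₁ + 1 by omega, poch_succ p (t + m₁),
    poch_succ (3 / 2 : ℝ) (t + m₁), legendreLam_succ m₁]
  push_cast
  ring

set_option maxHeartbeats 800000 in
/-- **The Zeilberger step**: `(i+1) T(i+1,t) - (p+i) T(i,t) = G(i,t+1) - G(i,t)` for all `t ≤ k`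
(`T = mftConvTerm p · k ·`, `G = mftConvCert p · k ·`; `p > 1/2`). [folklore] -/
theorem mftConvTerm_step {p : ℝ} (hp : 1 / 2 < p) (i k t : ℕ) (ht : t ≤ k) :
    ((i : ℝ) + 1) * mftConvTerm p (i + 1) k t - (p + i) * mftConvTerm p i k t =
      mftConvCert p i k (t + 1) - mftConvCert p i k t := by
  rcases lt_trichotomy t (i + 1) with hlt | heq | hgt
  · -- `t ≤ i`
    obtain ⟨m₁, rfl⟩ : ∃ m₁, i = t + m₁ := ⟨i - t, by omega⟩
    rcases Nat.lt_or_ge t k with htk | htk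
    · -- generic: `t + 1 ≤ k`, all four terms live
      obtain ⟨m₂, rfl⟩ : ∃ m₂, k = t + (m₂ + 1) := ⟨k - t - 1, by omega⟩
      unfold mftConvCert
      rw [mftConvTerm_gen₀, mftConvTerm_gen₁, mftConvTerm_gen₂]
      set a := poch (p - 1 / 2) t
      set B := poch p (t + m₁ + m₂ + 1)
      set f := (t.factorial : ℝ)
      set G := poch (3 / 2) (t + m₁ + m₂ + 1)
      set L1 := legendreLam m₁
      set L2 := legendreLam m₂
      have hf : f ≠ 0 := by positivity
      have hG : G ≠ 0 := poch_ne_zero (by norm_num) _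
      have h1 : (2 * (m₁ : ℝ) + 2) ≠ 0 := by positivity
      have h2 : (2 * (m₂ : ℝ) + 2) ≠ 0 := by positivity
      have h3 : ((t : ℝ) + 1) ≠ 0 := by positivity
      have h4 : (3 / 2 + ((t : ℝ) + m₁ + m₂ + 1)) ≠ 0 := by positivity
      have h5 : (2 * (m₁ : ℝ) + 2 * m₂ + 5) ≠ 0 := by positivity
      have h6 : (2 * (m₁ : ℝ) + 2 * m₂ + 1) ≠ 0 := by positivity
      push_cast
      have e5 : (2 : ℝ) * ((t : ℝ) + m₁ + 1 + ((t : ℝ) + ((m₂ : ℝ) + 1))) - 4 * (t : ℝ) + 1 =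
          2 * (m₁ : ℝ) + 2 * m₂ + 5 := by ring
      have e6 : (2 : ℝ) * ((t : ℝ) + m₁ + 1 + ((t : ℝ) + ((m₂ : ℝ) + 1))) - 4 * ((t : ℝ) + 1) + 1 =
          2 * (m₁ : ℝ) + 2 * m₂ + 1 := by ring
      have e7 : (2 : ℝ) * ((t : ℝ) + ((m₂ : ℝ) + 1)) - 2 * (t : ℝ) + 1 = 2 * (m₂ : ℝ) + 3 := by ring
      have e8 : (2 : ℝ) * ((t : ℝ) + ((m₂ : ℝ) + 1)) - 2 * ((t : ℝ) + 1) + 1 = 2 * (m₂ : ℝ) + 1 := by ring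
      rw [e5, e6, e7, e8]
      field_simp
      ring
    · -- boundary `t = k ≤ i`: `G(i, k+1) = 0`
      have htk' : t = k := le_antisymm ht htk
      subst htk'
      unfold mftConvCert
      rw [mftConvTerm_of_lt_right p (i := t + m₁ + 1) (k := t) (t := t + 1) (by omega), mul_zero, zero_sub,
        mftConvTerm_bdry₀, mftConvTerm_bdry₁]
      set a := poch (p - 1 / 2) t
      set B := poch p (t + m₁)
      set f := (t.factorial : ℝ)
      set G := poch (3 / 2) (t + m₁)
      set L1 := legendreLam m₁
      have hf : f ≠ 0 := by positivity
      have hG : G ≠ 0 := poch_ne_zero (by norm_num) _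
      have h1 : (2 * (m₁ : ℝ) + 2) ≠ 0 := by positivity
      have h4 : (3 / 2 + ((t : ℝ) + m₁)) ≠ 0 := by positivity
      have h5 : (2 * (m₁ : ℝ) + 3) ≠ 0 := by positivity
      push_cast
      have e5 : (2 : ℝ) * ((t : ℝ) + m₁ + 1 + (t : ℝ)) - 4 * (t : ℝ) + 1 = 2 * (m₁ : ℝ) + 3 := by ring
      have e7 : (2 : ℝ) * (t : ℝ) - 2 * (t : ℝ) + 1 = 1 := by ring
      rw [e5, e7]
      field_simp
      ring
  · -- boundary `t = i + 1 ≤ k`: `T(i, t) = 0`, `G(i, t+1) = 0`, and `(i+1) T(i+1,i+1) = -G(i,i+1)`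
    subst heq
    unfold mftConvCert
    rw [mftConvTerm_of_lt_left p (i := i) (t := i + 1) (by omega),
      mftConvTerm_of_lt_left p (i := i + 1) (t := i + 1 + 1) (by omega)]
    have h : (2 * ((i : ℝ) + 1 + k) - 4 * (((i + 1 : ℕ) : ℝ)) + 1) ≠ 0 := by
      push_cast
      intro h0
      have h' : (2 * k : ℤ) = 2 * i + 1 := by
        have : (2 : ℝ) * k = 2 * i + 1 := by linarith
        exact_mod_cast this
      omega
    have e : (2 * (k : ℝ) - 2 * (((i + 1 : ℕ) : ℝ)) + 1) =
        (2 * ((i : ℝ) + 1 + k) - 4 * (((i + 1 : ℕ) : ℝ)) + 1) := by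
      push_cast; ring
    rw [e]
    field_simp
    push_cast
    ring
  · -- `t ≥ i + 2`: everything vanishes
    rw [mftConvTerm_of_lt_left p (by omega), mftConvTerm_of_lt_left p (by omega),
      mftConvCert_of_lt_left p (by omega), mftConvCert_of_lt_left p (by omega)]
    ring

/-- The conversion sum `S(i,k) = Σ_{t ≤ k} T(i,t)` (terms with `t > min(i,k)` vanish). [folklore] -/
noncomputable def mftConvSum (p : ℝ) (i k : ℕ) : ℝ := ∑ t ∈ range (k + 1), mftConvTerm p i k t

/-- **The recursion** `(i+1) S(i+1,k) = (p+i) S(i,k)` (telescoping the Zeilberger step). [folklore] -/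
theorem mftConvSum_succ {p : ℝ} (hp : 1 / 2 < p) (i k : ℕ) :
    ((i : ℝ) + 1) * mftConvSum p (i + 1) k = (p + i) * mftConvSum p i k := by
  unfold mftConvSum
  rw [mul_sum, mul_sum, ← sub_eq_zero, ← sum_sub_distrib]
  calc ∑ t ∈ range (k + 1), (((i : ℝ) + 1) * mftConvTerm p (i + 1) k t - (p + i) * mftConvTerm p i k t)
      = ∑ t ∈ range (k + 1), (mftConvCert p i k (t + 1) - mftConvCert p i k t) :=
        sum_congr rfl fun t ht => mftConvTerm_step hp i k t (by rw [Finset.mem_range] at ht; omega)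
    _ = mftConvCert p i k (k + 1) - mftConvCert p i k 0 := sum_range_sub _ _
    _ = 0 := by rw [mftConvCert_of_lt_right p (by omega), mftConvCert_zero, sub_zero]

/-- The initial value `S(0,k) = (p)_k / k!`. [folklore] -/
theorem mftConvSum_zero_left (p : ℝ) (k : ℕ) : mftConvSum p 0 k = poch p k / (k.factorial : ℝ) := by
  unfold mftConvSum
  rw [sum_eq_single_of_mem 0 (Finset.mem_range.mpr (by omega)) fun t _ ht => mftConvTerm_of_lt_left p (by omega),
    mftConvTerm_of_eq p (i := 0) (k := k) (t := 0) 0 k (by simp) (by simp), legendreLam_zero,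
    legendreLam_eq_poch k, poch_threeHalves]
  have hk : (k.factorial : ℝ) ≠ 0 := by positivity
  have hq : poch (1 / 2) k ≠ 0 := poch_ne_zero (by norm_num) k
  have h2 : (2 * (k : ℝ) + 1) ≠ 0 := by positivity
  simp only [poch_zero, Nat.factorial_zero, Nat.cast_one, one_mul, zero_add, Nat.cast_zero]
  field_simp

/-- **The conversion sum in closed form**: `S(i,k) = (p)_i (p)_k / (i! k!)` (`p > 1/2`). [folklore] -/
theorem mftConvSum_eq {p : ℝ} (hp : 1 / 2 < p) (i k : ℕ) :
    mftConvSum p i k = poch p i * poch p k / ((i.factorial : ℝ) * k.factorial) := by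
  induction i with
  | zero => rw [mftConvSum_zero_left]; simp
  | succ i ih =>
    have hi : ((i : ℝ) + 1) ≠ 0 := by positivity
    have h := mftConvSum_succ hp i k
    rw [ih] at h
    rw [poch_succ, Nat.factorial_succ]
    have hf : (i.factorial : ℝ) ≠ 0 := by positivity
    have hg : (k.factorial : ℝ) ≠ 0 := by positivity
    push_cast
    field_simp
    field_simp at h
    linear_combination h

/-- On its support `mftConvTerm` is `gg(p; t, N-t) λ_{i-t} λ_{k-t}`. [folklore] -/
theorem mftConvTerm_eq_ggVal (p : ℝ) {i k t : ℕ} (hi : t ≤ i) (hk : t ≤ k) :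
    mftConvTerm p i k t = ggVal p t (i + k - t) * (legendreLam (i - t) * legendreLam (k - t)) := by
  unfold mftConvTerm ggVal
  rw [if_pos ⟨hi, hk⟩]
  have e : (((i + k - t : ℕ) : ℝ)) = (i : ℝ) + k - t := by
    rw [Nat.cast_sub (by omega)]; push_cast; ring
  rw [e]
  ring

/-- **Re-indexing**: `Σ_{j ≤ N} gg(p; N, j) e_{N,j}(i,k) = S(i,k)` (`N = i + k`; only `j = N - 2t`,
`t ≤ min(i,k)`, contribute, with `e_{N,N-2t}(i,k) = λ_{i-t} λ_{k-t}`). [folklore] -/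
theorem sum_ggArr_mul_legendreArrDeg (p : ℝ) (i k N : ℕ) (hN : i + k = N) :
    ∑ j ∈ range (N + 1), ggArr p N j * legendreArrDeg N j (i, k) = mftConvSum p i k := by
  -- both sides equal `Σ_{t ≤ k} [t ≤ i] G t`
  set G : ℕ → ℝ := fun t => ggVal p t (i + k - t) * (legendreLam (i - t) * legendreLam (k - t)) with hG
  have hR : mftConvSum p i k = ∑ t ∈ range (k + 1), (if t ≤ i then G t else 0) := by
    unfold mftConvSum
    refine sum_congr rfl fun t ht => ?_
    rw [Finset.mem_range] at ht
    split_ifs with h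
    · exact mftConvTerm_eq_ggVal p h (by omega)
    · exact mftConvTerm_of_lt_left p (by omega)
  have hL : ∀ j ∈ range (N + 1), ggArr p N j * legendreArrDeg N j (i, k) =
      ∑ t ∈ range (k + 1), (if j + 2 * t = N then (if t ≤ i then G t else 0) else 0) := by
    intro j hj
    rw [Finset.mem_range] at hj
    by_cases hpar : (N + j) % 2 = 0
    · -- `j = N - 2 t₀`
      obtain ⟨t₀, ht₀⟩ : ∃ t₀, j + 2 * t₀ = N := ⟨(N - j) / 2, by omega⟩
      have hsum : ∑ t ∈ range (k + 1), (if j + 2 * t = N then (if t ≤ i then G t else 0) else 0) =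
          ∑ t ∈ range (k + 1), (if t = t₀ then (if t ≤ i then G t else 0) else 0) := by
        refine sum_congr rfl fun t _ => ?_
        by_cases h : t = t₀
        · rw [if_pos (by omega), if_pos h]
        · rw [if_neg (by omega), if_neg h]
      rw [hsum, sum_ite_eq' (range (k + 1)) t₀]
      -- evaluate the left side
      have hgg : ggArr p N j = ggVal p t₀ (N - t₀) :=
        ggArr_of_supp p t₀ (N - t₀) (by push_cast [Nat.cast_sub (show t₀ ≤ N by omega)]; ring)
          (by push_cast [Nat.cast_sub (show t₀ ≤ N by omega)]; linarith [ht₀]) (by omega)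
      rw [hgg]
      unfold legendreArrDeg
      rw [if_pos ⟨by omega, hpar⟩, show (N - j) / 2 = t₀ by omega]
      by_cases htk : t₀ ≤ k
      · rw [if_pos (Finset.mem_range.mpr (by omega))]
        by_cases hti : t₀ ≤ i
        · rw [legendreArr_pair t₀ j i k (i - t₀) (k - t₀) (by omega) (by omega) (by omega), if_pos hti, hG]
          simp only
          rw [show i + k - t₀ = N - t₀ by omega]
        · rw [legendreArr_pair_eq_zero t₀ j i k (by omega), if_neg hti, mul_zero]
      · rw [if_neg (fun h => htk (by have := Finset.mem_range.mp h; omega)),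
          legendreArr_pair_eq_zero t₀ j i k (by omega), mul_zero]
    · -- wrong parity: both sides vanish
      have h0 : legendreArrDeg N j (i, k) = 0 := by
        unfold legendreArrDeg; rw [if_neg (by omega)]; rfl
      rw [h0, mul_zero]
      symm
      exact sum_eq_zero fun t _ => by rw [if_neg (by omega)]
  rw [sum_congr rfl hL, sum_comm, hR]
  refine sum_congr rfl fun t ht => ?_
  rw [Finset.mem_range] at ht
  have hsum : ∑ j ∈ range (N + 1), (if j + 2 * t = N then (if t ≤ i then G t else 0) else 0) =
      ∑ j ∈ range (N + 1), (if j = N - 2 * t then (if t ≤ i then (if t ≤ i then G t else 0) else 0) else 0) := by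
    refine sum_congr rfl fun j _ => ?_
    by_cases hti : t ≤ i
    · simp only [if_pos hti]
      by_cases h : j + 2 * t = N
      · rw [if_pos h, if_pos (by omega)]
      · rw [if_neg h, if_neg (by omega)]
    · simp [hti]
  rw [hsum, sum_ite_eq' (range (N + 1)), if_pos (Finset.mem_range.mpr (by omega))]
  split_ifs <;> rfl

/-- **The conversion identity**: `Σ_{j ≤ N} gg(p; N, j) e_{N,j}(i,k) = (p)_i (p)_k / (i! k!)` (`N = i+k`,
`p > 1/2`): the `𝒫`-frame array `gg(p)` is the monomial array of `(1-z)^{-p}(1-z̄)^{-p}`. [folklore] -/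
theorem gg_conversion {p : ℝ} (hp : 1 / 2 < p) (i k N : ℕ) (hN : i + k = N) :
    ∑ j ∈ range (N + 1), ggArr p N j * legendreArrDeg N j (i, k) =
      poch p i * poch p k / ((i.factorial : ℝ) * k.factorial) := by
  rw [sum_ggArr_mul_legendreArrDeg p i k N hN, mftConvSum_eq hp]

/-! ### 2. The block arrays in the common monomial frame -/

/-- Shifting the degree-indexed Legendre arrays: `e_{N,j}(i,k) = e_{N-2n,j}(i-n,k-n)` for `n ≤ i`, `n ≤ k`,
`j + 2n ≤ N = i + k`. [folklore] -/
theorem legendreArrDeg_shift {N j i k n : ℕ} (hN : i + k = N) (hi : n ≤ i) (hk : n ≤ k) (hj : j + 2 * n ≤ N) :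
    legendreArrDeg N j (i, k) = legendreArrDeg (N - 2 * n) j (i - n, k - n) := by
  unfold legendreArrDeg
  by_cases hpar : (N + j) % 2 = 0
  · rw [if_pos ⟨by omega, hpar⟩, if_pos ⟨by omega, by omega⟩]
    set t := (N - j) / 2 with ht
    have ht' : (N - 2 * n - j) / 2 = t - n := by omega
    rw [ht']
    by_cases h1 : t ≤ i ∧ t ≤ k
    · rw [legendreArr_pair t j i k (i - t) (k - t) (by omega) (by omega) (by omega),
        legendreArr_pair (t - n) j (i - n) (k - n) (i - t) (k - t) (by omega) (by omega) (by omega)]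
    · rw [legendreArr_pair_eq_zero t j i k (by omega),
        legendreArr_pair_eq_zero (t - n) j (i - n) (k - n) (by omega)]
  · rw [if_neg (by omega), if_neg (by omega)]; rfl

/-- **The block `(2p+2n+ℓ, ℓ)` in the common frame**: its monomial array shifted by `(z z̄)^n`,
`[n ≤ i, n ≤ k] · k^{(2p+2n+ℓ,ℓ)}_{(i-n,k-n)}`, equals `Σ_j blockArr p n ℓ N j / λ_ℓ · e_{N,j}(i,k)`
(`N = i + k`). [cite: HogervorstRychkov2013, §3 eqs. (3.4)–(3.6)] -/
theorem hrMonomialCoeff_shift (p : ℝ) (n ℓ i k N : ℕ) (hN : i + k = N) :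
    (if n ≤ i ∧ n ≤ k then hrMonomialCoeff (2 * p + 2 * n + ℓ) ℓ (i - n, k - n) else 0) =
      ∑ j ∈ range (N + 1), blockArr p n ℓ N j / legendreLam ℓ * legendreArrDeg N j (i, k) := by
  by_cases hn : n ≤ i ∧ n ≤ k
  · rw [if_pos hn]
    by_cases hℓ : 2 * n + ℓ ≤ N
    · rw [hrMonomialCoeff_eq_slice _ _ (N := N - 2 * n) (by simp only; omega) (by omega)]
      unfold hrSlice
      -- shrink the range `N + 1` to `N - 2n + 1` (zero terms), and compare termwise
      have hext : ∑ j ∈ range (N + 1), blockArr p n ℓ N j / legendreLam ℓ * legendreArrDeg N j (i, k) =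
          ∑ j ∈ range (N - 2 * n + 1), blockArr p n ℓ N j / legendreLam ℓ * legendreArrDeg N j (i, k) := by
        refine (sum_subset (range_subset_range.mpr (by omega)) fun j hj hj' => ?_).symm
        rw [Finset.mem_range] at hj hj'
        have h0 : blockArr p n ℓ N j = 0 := by
          unfold blockArr
          apply hrCoeffZ_eq_zero_of_not_inRangeZ
          rintro ⟨-, -, h3, -⟩
          push_cast at h3
          omega
        rw [h0, zero_div, zero_mul]
      rw [hext]
      refine sum_congr rfl fun j hj => ?_
      rw [Finset.mem_range] at hj
      have hb : blockArr p n ℓ N j = hrCoeff (2 * p + 2 * n + ℓ) ℓ (N - 2 * n - ℓ) j := by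
        unfold blockArr
        rw [show ((N : ℤ)) - ((2 * n + ℓ : ℕ) : ℤ) = ((N - 2 * n - ℓ : ℕ) : ℤ) by push_cast; omega,
          hrCoeffZ_natCast]
      rw [hb, legendreArrDeg_shift hN hn.1 hn.2 (by omega)]
    · rw [hrMonomialCoeff_eq_zero_of_lt _ _ (by simp only; omega)]
      symm
      refine sum_eq_zero fun j _ => ?_
      rw [blockArr_eq_zero_of_lt p (by push_cast; omega), zero_div, zero_mul]
  · rw [if_neg hn]
    symm
    refine sum_eq_zero fun j hj => ?_
    rw [Finset.mem_range] at hj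
    -- either the block array or the Legendre array vanishes
    by_cases he : legendreArrDeg N j (i, k) = 0
    · rw [he, mul_zero]
    · have hcond : j ≤ N ∧ (N + j) % 2 = 0 ∧ (N - j) / 2 ≤ i ∧ (N - j) / 2 ≤ k := by
        unfold legendreArrDeg at he
        by_cases hc : j ≤ N ∧ (N + j) % 2 = 0
        · rw [if_pos hc] at he
          refine ⟨hc.1, hc.2, ?_, ?_⟩ <;> by_contra hlt <;> apply he <;>
            exact legendreArr_pair_eq_zero _ j i k (by omega)
        · exfalso; apply he; rw [if_neg hc]; rfl
      have h0 : blockArr p n ℓ N j = 0 := by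
        unfold blockArr
        by_cases hlev : (2 * n + ℓ : ℕ) ≤ (N : ℤ)
        · apply hrCoeffZ_eq_zero_of_not_inRangeZ
          rintro ⟨-, -, h3, -⟩
          push_cast at h3 hlev
          omega
        · exact hrCoeffZ_of_neg_left _ _ (by omega) _
      rw [h0, zero_div, zero_mul]

/-- `blockSum` is additive in the coefficient family. [folklore] -/
theorem blockSum_add (p : ℝ) (a b : ℕ → ℕ → ℝ) (M j : ℤ) :
    blockSum p (fun n ℓ => a n ℓ + b n ℓ) M j = blockSum p a M j + blockSum p b M j := by
  unfold blockSum
  simp only [add_mul, sum_add_distrib]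

/-- The `δ` array against the Legendre arrays: `Σ_j δ(N,j) e_{N,j}(i,k) = δ_{N,0}` (`N = i + k`). [folklore] -/
theorem sum_deltaArr_mul_legendreArrDeg (i k N : ℕ) (hN : i + k = N) :
    ∑ j ∈ range (N + 1), deltaArr N j * legendreArrDeg N j (i, k) = if N = 0 then 1 else 0 := by
  by_cases h0 : N = 0
  · subst h0
    have hi : i = 0 := by omega
    have hk : k = 0 := by omega
    subst hi hk
    rw [if_pos rfl, sum_range_one]
    have h1 : deltaArr ((0 : ℕ) : ℤ) ((0 : ℕ) : ℤ) = 1 := by simp [deltaArr]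
    have h2 : legendreArrDeg 0 0 (0, 0) = 1 := by
      unfold legendreArrDeg
      rw [if_pos ⟨le_rfl, by norm_num⟩, legendreArr_pair 0 0 0 0 0 0 (by simp) (by simp) (by simp),
        legendreLam_zero, mul_one]
    rw [h1, h2, mul_one]
  · rw [if_neg h0]
    refine sum_eq_zero fun j _ => ?_
    unfold deltaArr
    rw [if_neg (by omega), zero_mul]

/-- **The mean-field degree identity**: for every `(i, k)` (`N = i + k`, `p > 1/2`),
`Σ_{n ≤ N} Σ_{ℓ ≤ N} (1+(-1)^ℓ) P_{n,ℓ}(p) · [n ≤ i, n ≤ k] k^{(2p+2n+ℓ,ℓ)}_{(i-n,k-n)} = δ_{N,0} + (p)_i (p)_k/(i! k!)` —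
the coefficient of `(z z̄)^p z^i z̄^k` in `u^p + (u/v)^p = Σ_{n, ℓ even} 2 P_{n,ℓ} g_{2p+2n+ℓ,ℓ}`.
[cite: FitzpatrickKaplan2012, §2.2] -/
theorem mft_degree_identity {p : ℝ} (hp : 1 / 2 < p) (i k N : ℕ) (hN : i + k = N) :
    ∑ n ∈ range (N + 1), ∑ ℓ ∈ range (N + 1), (1 + (-1 : ℝ) ^ ℓ) * mftCoeff p n ℓ *
        (if n ≤ i ∧ n ≤ k then hrMonomialCoeff (2 * p + 2 * n + ℓ) ℓ (i - n, k - n) else 0) =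
      (if N = 0 then 1 else 0) + poch p i * poch p k / ((i.factorial : ℝ) * k.factorial) := by
  -- pass to the common frame and reorder the sums
  have step1 : ∀ n ∈ range (N + 1), ∑ ℓ ∈ range (N + 1), (1 + (-1 : ℝ) ^ ℓ) * mftCoeff p n ℓ *
      (if n ≤ i ∧ n ≤ k then hrMonomialCoeff (2 * p + 2 * n + ℓ) ℓ (i - n, k - n) else 0) =
      ∑ j ∈ range (N + 1), ∑ ℓ ∈ range (N + 1),
        ((1 + (-1 : ℝ) ^ ℓ) * mftCoeff p n ℓ / legendreLam ℓ * blockArr p n ℓ N j) *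
          legendreArrDeg N j (i, k) := by
    intro n _
    rw [sum_comm]
    refine sum_congr rfl fun ℓ _ => ?_
    rw [hrMonomialCoeff_shift p n ℓ i k N hN, mul_sum]
    refine sum_congr rfl fun j _ => ?_
    ring
  rw [sum_congr rfl step1, sum_comm]
  have step2 : ∀ j ∈ range (N + 1), ∑ n ∈ range (N + 1), ∑ ℓ ∈ range (N + 1),
      ((1 + (-1 : ℝ) ^ ℓ) * mftCoeff p n ℓ / legendreLam ℓ * blockArr p n ℓ N j) * legendreArrDeg N j (i, k) =
      (deltaArr N j + ggArr p N j) * legendreArrDeg N j (i, k) := by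
    intro j _
    rw [← congrFun (congrFun (blockSum_mft_alt_eq_delta hp) N) j,
      ← congrFun (congrFun (blockSum_mft_eq_ggArr hp) N) j, ← blockSum_add]
    unfold blockSum
    rw [Int.toNat_natCast, sum_mul]
    refine sum_congr rfl fun n _ => ?_
    rw [sum_mul]
    refine sum_congr rfl fun ℓ _ => ?_
    ring
  rw [sum_congr rfl step2]
  simp only [add_mul, sum_add_distrib]
  rw [sum_deltaArr_mul_legendreArrDeg i k N hN, gg_conversion hp i k N hN]



/-! ### 3. The binomial series `Σ_i (p)_i/i! x^i = (1-x)^{-p}` -/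

/-- `Ring.choose y k = ∏_{j<k} (y - j) / k!`. [folklore] -/
private theorem ringChoose_eq_prod_div (y : ℝ) (k : ℕ) :
    Ring.choose y k = (∏ j ∈ range k, (y - j)) / (Nat.factorial k : ℝ) := by
  rw [Ring.choose_eq_smul, ← Polynomial.aeval_eq_smeval, Polynomial.aeval_def,
    Polynomial.eval₂_eq_eval_map, descPochhammer_map, descPochhammer_eval_eq_prod_range,
    smul_eq_mul, div_eq_inv_mul]

/-- The generalized binomial coefficient `C(p + n - 1, n) = (p)_n / n!`. [folklore] -/
theorem ringChoose_eq_poch_div (p : ℝ) (n : ℕ) :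
    Ring.choose (p + n - 1) n = poch p n / (n.factorial : ℝ) := by
  rw [ringChoose_eq_prod_div]
  congr 1
  have h : ∏ j ∈ range n, (p + n - 1 - (j : ℝ)) = ∏ j ∈ range n, (p + ((n - 1 - j : ℕ) : ℝ)) := by
    refine prod_congr rfl fun j hj => ?_
    rw [Finset.mem_range] at hj
    rw [Nat.cast_sub (by omega), Nat.cast_sub (by omega)]
    push_cast
    ring
  rw [h, prod_range_reflect (fun i => p + (i : ℝ)) n]
  rfl

/-- **`Σ_i (p)_i/i! x^i = (1 - x)^{-p}`** for `|x| < 1` (the binomial series).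
Mathlib: `Real.one_div_one_sub_rpow_hasFPowerSeriesOnBall_zero`. [folklore] -/
theorem hasSum_poch_div_factorial_mul_pow (p : ℝ) {x : ℝ} (hx : |x| < 1) :
    HasSum (fun n => poch p n / (n.factorial : ℝ) * x ^ n) (1 / (1 - x) ^ p) := by
  have hmem : x ∈ Metric.eball (0 : ℝ) 1 := by
    rw [Metric.mem_eball, edist_zero_right, ← ofReal_norm, Real.norm_eq_abs]
    exact ENNReal.ofReal_lt_one.mpr hx
  have h := (Real.one_div_one_sub_rpow_hasFPowerSeriesOnBall_zero p).hasSum hmem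
  simp only [zero_add, FormalMultilinearSeries.ofScalars_apply_eq, smul_eq_mul, ringChoose_eq_poch_div] at h
  exact h

/-! ### 4. The rows: shifted block series -/

/-- The `z`-series of a block strictly above the unitarity bound, as a `HasSum` on the open square. [cite: HogervorstRychkov2013, §2.1 eq. (2.16)] -/
theorem hasSum_hrMonomialCoeff {Δ : ℝ} {ℓ : ℕ} (hΔ : unitarityBound3D ℓ < Δ) {z zb : ℝ}
    (hz : z ∈ Ioo (0 : ℝ) 1) (hzb : zb ∈ Ioo (0 : ℝ) 1) :
    HasSum (fun q : ℕ × ℕ => hrMonomialCoeff Δ ℓ q * z ^ q.1 * zb ^ q.2) (hrSeries Δ ℓ z zb) := by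
  have h := (isDoublePowerSeriesOn_hrSeries hΔ z zb (by rw [abs_of_pos hz.1]; exact hz.2)
    (by rw [abs_of_pos hzb.1]; exact hzb.2)).1
  have hsum : Summable fun q : ℕ × ℕ => hrMonomialCoeff Δ ℓ q * z ^ q.1 * zb ^ q.2 := by
    refine h.congr fun q => ?_
    rw [abs_of_nonneg (hrMonomialCoeff_nonneg hΔ q), abs_of_pos hz.1, abs_of_pos hzb.1]
  exact hsum.hasSum

/-- **A block series shifted by `(z z̄)^n`** as a double power series: the coefficient of `z^i z̄^k` is
`[n ≤ i, n ≤ k] k_{(i-n, k-n)}`. [cite: HogervorstRychkov2013, §2.1 eq. (2.16)] -/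
theorem hasSum_hrMonomialCoeff_shift {Δ : ℝ} {ℓ : ℕ} (hΔ : unitarityBound3D ℓ < Δ) (n : ℕ) {z zb : ℝ}
    (hz : z ∈ Ioo (0 : ℝ) 1) (hzb : zb ∈ Ioo (0 : ℝ) 1) :
    HasSum (fun q : ℕ × ℕ =>
        (if n ≤ q.1 ∧ n ≤ q.2 then hrMonomialCoeff Δ ℓ (q.1 - n, q.2 - n) else 0) * z ^ q.1 * zb ^ q.2)
      ((z * zb) ^ n * hrSeries Δ ℓ z zb) := by
  set f : ℕ × ℕ → ℝ := fun q =>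
    (if n ≤ q.1 ∧ n ≤ q.2 then hrMonomialCoeff Δ ℓ (q.1 - n, q.2 - n) else 0) * z ^ q.1 * zb ^ q.2 with hf
  set g : ℕ × ℕ → ℕ × ℕ := fun q => (q.1 + n, q.2 + n) with hg
  have hginj : Function.Injective g := by
    intro a b h
    simp only [hg, Prod.mk.injEq] at h
    exact Prod.ext (by omega) (by omega)
  have hzero : ∀ x ∉ Set.range g, f x = 0 := by
    intro x hx
    have hx' : ¬ (n ≤ x.1 ∧ n ≤ x.2) := by
      rintro ⟨h1, h2⟩
      exact hx ⟨(x.1 - n, x.2 - n), by simp only [hg]; exact Prod.ext (by omega) (by omega)⟩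
    simp only [hf, if_neg hx', zero_mul]
  rw [← hginj.hasSum_iff hzero]
  have hcomp : f ∘ g = fun q : ℕ × ℕ => (z * zb) ^ n * (hrMonomialCoeff Δ ℓ q * z ^ q.1 * zb ^ q.2) := by
    funext q
    simp only [Function.comp, hf, hg, if_pos (And.intro (Nat.le_add_left n q.1) (Nat.le_add_left n q.2)),
      Nat.add_sub_cancel, pow_add, mul_pow]
    ring
  rw [hcomp]
  exact (hasSum_hrMonomialCoeff hΔ hz hzb).mul_left _

/-! ### 5. The decomposition `1 + (1-z)^{-p}(1-z̄)^{-p} = Σ_{n,ℓ} (1+(-1)^ℓ) P_{n,ℓ} (z z̄)^n K_{2p+2n+ℓ,ℓ}` -/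

/-- `1 + (-1)^ℓ ≥ 0`. [folklore] -/
theorem one_add_neg_one_pow_nonneg (ℓ : ℕ) : (0 : ℝ) ≤ 1 + (-1 : ℝ) ^ ℓ := by
  rcases neg_one_pow_eq_or ℝ ℓ with h | h <;> rw [h] <;> norm_num

/-- **The mean-field decomposition, `z`-series form**: for `z, z̄ ∈ (0,1)` and `p > 1/2`,
`Σ_{n,ℓ} (1+(-1)^ℓ) P_{n,ℓ}(p) (z z̄)^n K^{HR}_{2p+2n+ℓ,ℓ}(z,z̄) = (1-z)^{-p}(1-z̄)^{-p} + 1`, the family being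
summable (all terms non-negative). Proof: Tonelli on the non-negative family
`(1+(-1)^ℓ) P_{n,ℓ} [n ≤ i,k] k^{(n,ℓ)}_{(i-n,k-n)} z^i z̄^k`, the degree identity `mft_degree_identity`, and the
binomial series. [cite: FitzpatrickKaplan2012, §2.2] -/
theorem hasSum_meanField_series {p : ℝ} (hp : 1 / 2 < p) {z zb : ℝ} (hz : z ∈ Ioo (0 : ℝ) 1)
    (hzb : zb ∈ Ioo (0 : ℝ) 1) :
    HasSum (fun m : ℕ × ℕ => (1 + (-1 : ℝ) ^ m.2) * mftCoeff p m.1 m.2 *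
        ((z * zb) ^ m.1 * hrSeries (2 * p + 2 * m.1 + m.2) m.2 z zb))
      (1 / (1 - z) ^ p * (1 / (1 - zb) ^ p) + 1) := by
  -- the non-negative family on `(ℕ × ℕ) × (ℕ × ℕ)` (monomial index, operator index)
  set F : (ℕ × ℕ) × (ℕ × ℕ) → ℝ := fun qm => (1 + (-1 : ℝ) ^ qm.2.2) * mftCoeff p qm.2.1 qm.2.2 *
    ((if qm.2.1 ≤ qm.1.1 ∧ qm.2.1 ≤ qm.1.2 then
        hrMonomialCoeff (2 * p + 2 * qm.2.1 + qm.2.2) qm.2.2 (qm.1.1 - qm.2.1, qm.1.2 - qm.2.1) else 0) *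
      z ^ qm.1.1 * zb ^ qm.1.2) with hF
  set V : ℕ × ℕ → ℝ := fun q => ((if q.1 + q.2 = 0 then 1 else 0) +
    poch p q.1 * poch p q.2 / ((q.1.factorial : ℝ) * q.2.factorial)) * (z ^ q.1 * zb ^ q.2) with hV
  -- fibre sums over the operator index: the degree identity
  have hinner : ∀ q : ℕ × ℕ, HasSum (fun m => F (q, m)) (V q) := by
    intro q
    set N := q.1 + q.2 with hN
    have hzero : ∀ m ∉ range (N + 1) ×ˢ range (N + 1), F (q, m) = 0 := by
      intro m hm
      rw [Finset.mem_product, Finset.mem_range, Finset.mem_range, not_and_or, not_lt, not_lt] at hm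
      simp only [hF]
      rcases hm with h1 | h2
      · rw [if_neg (by omega)]; ring
      · split_ifs with hc
        · rw [hrMonomialCoeff_eq_zero_of_lt _ _ (by simp only; omega)]; ring
        · ring
    have hfin : HasSum (fun m => F (q, m)) (∑ m ∈ range (N + 1) ×ˢ range (N + 1), F (q, m)) :=
      hasSum_sum_of_ne_finset_zero hzero
    have hval : ∑ m ∈ range (N + 1) ×ˢ range (N + 1), F (q, m) = V q := by
      rw [Finset.sum_product, hV]
      simp only
      rw [← mft_degree_identity hp q.1 q.2 N hN.symm, sum_mul]
      refine sum_congr rfl fun n _ => ?_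
      rw [sum_mul]
      refine sum_congr rfl fun ℓ _ => ?_
      simp only [hF]
      ring
    rwa [hval] at hfin
  -- the fibre sums form the Cauchy square of the binomial series plus the identity term
  have hVsum : HasSum V (1 / (1 - z) ^ p * (1 / (1 - zb) ^ p) + 1) := by
    have h1 := hasSum_poch_div_factorial_mul_pow p (x := z) (by rw [abs_of_pos hz.1]; exact hz.2)
    have h2 := hasSum_poch_div_factorial_mul_pow p (x := zb) (by rw [abs_of_pos hzb.1]; exact hzb.2)
    have hp0 : 0 < p := by linarith
    have hnn1 : 0 ≤ fun n => poch p n / (n.factorial : ℝ) * z ^ n := fun n =>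
      mul_nonneg (div_nonneg (poch_pos hp0 n).le (by positivity)) (pow_nonneg hz.1.le n)
    have hnn2 : 0 ≤ fun n => poch p n / (n.factorial : ℝ) * zb ^ n := fun n =>
      mul_nonneg (div_nonneg (poch_pos hp0 n).le (by positivity)) (pow_nonneg hzb.1.le n)
    have hprod := h1.mul h2 (h1.summable.mul_of_nonneg h2.summable hnn1 hnn2)
    have hδ : HasSum (fun q : ℕ × ℕ => if q = (0, 0) then (1 : ℝ) else 0) 1 := hasSum_ite_eq (0, 0) 1
    have hVeq : V = fun q : ℕ × ℕ =>
        poch p q.1 / (q.1.factorial : ℝ) * z ^ q.1 * (poch p q.2 / (q.2.factorial : ℝ) * zb ^ q.2) +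
          (if q = (0, 0) then (1 : ℝ) else 0) := by
      funext q
      obtain ⟨i, k⟩ := q
      simp only [hV]
      by_cases h0 : i + k = 0
      · have hi : i = 0 := by omega
        have hk : k = 0 := by omega
        subst hi hk
        simp
      · rw [if_neg h0, if_neg (by simp only [Prod.mk.injEq]; omega)]
        ring
    rw [hVeq]
    exact hprod.add hδ
  -- Tonelli: the family is summable, with total the sum of the fibre sums
  have hFnn : 0 ≤ F := by
    intro qm
    simp only [hF, Pi.zero_apply]
    refine mul_nonneg (mul_nonneg (one_add_neg_one_pow_nonneg _) (mftCoeff_nonneg hp _ _))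
      (mul_nonneg (mul_nonneg ?_ (pow_nonneg hz.1.le _)) (pow_nonneg hzb.1.le _))
    split_ifs
    · exact hrMonomialCoeff_nonneg (unitarityBound3D_lt_twist hp _ _) _
    · exact le_rfl
  have hFsum : Summable F := by
    refine (summable_prod_of_nonneg hFnn).mpr ⟨fun q => (hinner q).summable, ?_⟩
    have : (fun q : ℕ × ℕ => ∑' m, F (q, m)) = V := funext fun q => (hinner q).tsum_eq
    rw [this]
    exact hVsum.summable
  have htot : HasSum F (∑' qm, F qm) := hFsum.hasSum
  have hval : ∑' qm, F qm = 1 / (1 - z) ^ p * (1 / (1 - zb) ^ p) + 1 :=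
    (htot.prod_fiberwise hinner).unique hVsum
  -- and, summing the other way, the total is the block series
  have hswap : HasSum (fun mq : (ℕ × ℕ) × (ℕ × ℕ) => F (mq.2, mq.1)) (∑' qm, F qm) :=
    (Equiv.prodComm (ℕ × ℕ) (ℕ × ℕ)).hasSum_iff.mpr htot
  have hrow : ∀ m : ℕ × ℕ, HasSum (fun q : ℕ × ℕ => F (q, m))
      ((1 + (-1 : ℝ) ^ m.2) * mftCoeff p m.1 m.2 *
        ((z * zb) ^ m.1 * hrSeries (2 * p + 2 * m.1 + m.2) m.2 z zb)) := fun m =>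
    (hasSum_hrMonomialCoeff_shift (unitarityBound3D_lt_twist hp m.1 m.2) m.1 hz hzb).mul_left _
  rw [← hval]
  exact hswap.prod_fiberwise hrow

/-! ### 5b. The block form and the even-spin indexing -/

/-- **The identity-subtracted four-point function of a generalised free scalar of dimension `p` in `d = 3`**
in the `⟨σσσσ⟩` conventions of the `σ–ε` system: `𝒢(u,v) - 1 = u^p + (u/v)^p = (z z̄)^p (1 + ((1-z)(1-z̄))^{-p})`.
[cite: FitzpatrickKaplan2012, §2.2] -/
noncomputable def meanFieldCorrelator (p z zb : ℝ) : ℝ :=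
  (z * zb) ^ p * (1 + 1 / ((1 - z) * (1 - zb)) ^ p)

/-- The mean-field decomposition in block form, indexed by `(n, ℓ)` with the parity weight `1 + (-1)^ℓ`.
[cite: FitzpatrickKaplan2012, §2.2] -/
theorem hasSum_meanField_blocks {p : ℝ} (hp : 1 / 2 < p) {z zb : ℝ} (hz : z ∈ Ioo (0 : ℝ) 1)
    (hzb : zb ∈ Ioo (0 : ℝ) 1) :
    HasSum (fun m : ℕ × ℕ => (1 + (-1 : ℝ) ^ m.2) * mftCoeff p m.1 m.2 *
        hrBlock (2 * p + 2 * m.1 + m.2) m.2 z zb) (meanFieldCorrelator p z zb) := by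
  have h := (hasSum_meanField_series hp hz hzb).mul_left ((z * zb) ^ p)
  have hu : 0 < z * zb := mul_pos hz.1 hzb.1
  have hfun : (fun m : ℕ × ℕ => (1 + (-1 : ℝ) ^ m.2) * mftCoeff p m.1 m.2 *
      hrBlock (2 * p + 2 * m.1 + m.2) m.2 z zb) =
      fun m => (z * zb) ^ p * ((1 + (-1 : ℝ) ^ m.2) * mftCoeff p m.1 m.2 *
        ((z * zb) ^ m.1 * hrSeries (2 * p + 2 * m.1 + m.2) m.2 z zb)) := by
    funext m
    unfold hrBlock
    have e : (2 * p + 2 * (m.1 : ℝ) + (m.2 : ℝ) - (m.2 : ℝ)) / 2 = p + (m.1 : ℝ) := by ring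
    rw [e, Real.rpow_add hu, Real.rpow_natCast]
    ring
  have hval : meanFieldCorrelator p z zb = (z * zb) ^ p * (1 / (1 - z) ^ p * (1 / (1 - zb) ^ p) + 1) := by
    unfold meanFieldCorrelator
    rw [Real.mul_rpow (x := 1 - z) (y := 1 - zb) (sub_nonneg.mpr hz.2.le) (sub_nonneg.mpr hzb.2.le)]
    ring
  rw [hfun, hval]
  exact h

/-- **The squared OPE coefficients of the generalised free scalar of dimension `p` in `d = 3`**, indexed by
`(n, m)` ↦ the double-twist operator `[φφ]_{n,2m}` of dimension `2p + 2n + 2m` and spin `2m`: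
`λ² = 2 P_{n,2m}(p)` in the normalisation `k_{ℓ,0} = 1` of the typed blocks. [cite: FitzpatrickKaplan2012, §2.2] -/
noncomputable def gffOPECoeffSq (p : ℝ) (nm : ℕ × ℕ) : ℝ := 2 * mftCoeff p nm.1 (2 * nm.2)

/-- The squared OPE coefficients are positive for `p > 1/2`. [cite: FitzpatrickKaplan2012, §2.2] -/
theorem gffOPECoeffSq_pos {p : ℝ} (hp : 1 / 2 < p) (nm : ℕ × ℕ) : 0 < gffOPECoeffSq p nm := by
  unfold gffOPECoeffSq
  have := mftCoeff_pos hp nm.1 (2 * nm.2)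
  positivity

/-- **The conformal block decomposition of the generalised free four-point function in `d = 3`**: on the open
square and for every `p > 1/2`, `𝒢(z,z̄) - 1 = Σ_{n,m ≥ 0} 2 P_{n,2m}(p) g_{2p+2n+2m, 2m}(z,z̄)` with the typed
blocks `hrBlock`. [cite: FitzpatrickKaplan2012, §2.2] -/
theorem hasSum_gff_blocks {p : ℝ} (hp : 1 / 2 < p) {z zb : ℝ} (hz : z ∈ Ioo (0 : ℝ) 1)
    (hzb : zb ∈ Ioo (0 : ℝ) 1) :
    HasSum (fun nm : ℕ × ℕ => gffOPECoeffSq p nm *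
        hrBlock (2 * p + 2 * nm.1 + 2 * nm.2) (2 * nm.2) z zb) (meanFieldCorrelator p z zb) := by
  set f : ℕ × ℕ → ℝ := fun m => (1 + (-1 : ℝ) ^ m.2) * mftCoeff p m.1 m.2 *
    hrBlock (2 * p + 2 * m.1 + m.2) m.2 z zb with hf
  set g : ℕ × ℕ → ℕ × ℕ := fun nm => (nm.1, 2 * nm.2) with hg
  have hginj : Function.Injective g := by
    intro a b h
    simp only [hg, Prod.mk.injEq] at h
    exact Prod.ext h.1 (by omega)
  have hzero : ∀ x ∉ Set.range g, f x = 0 := by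
    intro x hx
    have hodd : Odd x.2 := by
      rcases Nat.even_or_odd x.2 with ⟨r, hr⟩ | ho
      · exact absurd ⟨(x.1, r), by simp only [hg]; exact Prod.ext rfl (by omega)⟩ hx
      · exact ho
    simp only [hf, hodd.neg_one_pow]
    ring
  have h := (hginj.hasSum_iff hzero).mpr (hasSum_meanField_blocks hp hz hzb)
  have hcomp : f ∘ g = fun nm : ℕ × ℕ => gffOPECoeffSq p nm *
      hrBlock (2 * p + 2 * nm.1 + 2 * nm.2) (2 * nm.2) z zb := by
    funext nm
    simp only [Function.comp, hf, hg, gffOPECoeffSq, (even_two_mul nm.2).neg_one_pow]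
    push_cast
    ring
  rwa [hcomp] at h

/-- The decomposition converges in particular on the diagonal (the convergence clause of A1). [folklore] -/
theorem summable_gff_blocks_diag {p : ℝ} (hp : 1 / 2 < p) {x : ℝ} (hx0 : 0 < x) (hx1 : x < 1) :
    Summable (fun nm : ℕ × ℕ => gffOPECoeffSq p nm * hrBlock (2 * p + 2 * nm.1 + 2 * nm.2) (2 * nm.2) x x) :=
  (hasSum_gff_blocks hp ⟨hx0, hx1⟩ ⟨hx0, hx1⟩).summable

/-! ### 6. The generalised free field as a `σ–ε` datum -/

/-- **The generalised free scalar of dimension `p` as a `σ–ε` datum**: `σ = φ` (`Δ_σ = p`), `ε = φ²`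
(`Δ_ε = 2p`); the even sector of `φ × φ` indexed by `(n, m) : ℕ × ℕ` — the double-twist operators
`[φφ]_{n,2m}` (`Δ = 2p + 2n + 2m`, `ℓ = 2m`), blocks `hrBlock`, coefficients `√(2 P_{n,2m}(p))`;
`λ_{εε𝒪} := 0` and an empty odd sector (fields not constrained by `SatisfiesSigmaAxioms`).
[cite: FitzpatrickKaplan2012, §2.2] -/
noncomputable def gffData (p : ℝ) : SigmaEpsilonData where
  Δσ := p
  Δε := 2 * p
  ιp := ℕ × ℕ
  Δp := fun nm => 2 * p + 2 * nm.1 + 2 * nm.2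
  ℓp := fun nm => 2 * nm.2
  lamσσ := fun nm => Real.sqrt (gffOPECoeffSq p nm)
  lamεε := fun _ => 0
  gp := fun nm => hrBlock (2 * p + 2 * nm.1 + 2 * nm.2) (2 * nm.2)
  ιm := Empty
  Δm := fun e => e.elim
  ℓm := fun e => e.elim
  lamσε := fun e => e.elim
  gmm := fun e => e.elim
  gpm := fun e => e.elim

/-- Unfolding: `Δ_σ = p`. [folklore] -/
@[simp] theorem gffData_Δσ (p : ℝ) : (gffData p).Δσ = p := rfl

/-- Unfolding: `Δ_ε = 2p`. [folklore] -/
@[simp] theorem gffData_Δε (p : ℝ) : (gffData p).Δε = 2 * p := rfl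

/-- The double-twist points are strictly above the unitarity bound for `p > 1/2`. [folklore] -/
theorem gff_unitarity {p : ℝ} (hp : 1 / 2 < p) (n m : ℕ) :
    unitarityBound3D (2 * m) < 2 * p + 2 * (n : ℝ) + 2 * (m : ℝ) := by
  have h := unitarityBound3D_lt_twist hp n (2 * m)
  push_cast at h
  exact h

/-- **Sum rule 1 for the generalised free field**: `Σ λ² F_{-,Δ,ℓ}(z,z̄) = -F_{-,𝟙}(z,z̄)` on the open square —
the decomposition at `(z,z̄)` and at `(1-z,1-z̄)` and `v^p 𝒢₁(z,z̄) - u^p 𝒢₁(1-z,1-z̄) = u^p - v^p` for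
`𝒢₁ = u^p (1 + v^{-p})`. [cite: FitzpatrickKaplan2012, §2.2] -/
theorem hasSum_gff_crossing {p : ℝ} (hp : 1 / 2 < p) {z zb : ℝ} (hz : z ∈ Ioo (0 : ℝ) 1)
    (hzb : zb ∈ Ioo (0 : ℝ) 1) :
    HasSum (fun nm : ℕ × ℕ => gffOPECoeffSq p nm *
        crossF p (-1) (hrBlock (2 * p + 2 * nm.1 + 2 * nm.2) (2 * nm.2)) z zb)
      (-(crossF p (-1) (fun _ _ => (1 : ℝ)) z zb)) := by
  have hz' : 1 - z ∈ Ioo (0 : ℝ) 1 := ⟨by linarith [hz.2], by linarith [hz.1]⟩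
  have hzb' : 1 - zb ∈ Ioo (0 : ℝ) 1 := ⟨by linarith [hzb.2], by linarith [hzb.1]⟩
  have h1 := hasSum_gff_blocks hp hz hzb
  have h2 := hasSum_gff_blocks hp hz' hzb'
  have h := (h1.mul_left (((1 - z) * (1 - zb)) ^ p)).add ((h2.mul_left ((z * zb) ^ p)).mul_left (-1))
  have hfun : (fun nm : ℕ × ℕ => gffOPECoeffSq p nm *
      crossF p (-1) (hrBlock (2 * p + 2 * nm.1 + 2 * nm.2) (2 * nm.2)) z zb) =
      fun nm => ((1 - z) * (1 - zb)) ^ p *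
          (gffOPECoeffSq p nm * hrBlock (2 * p + 2 * nm.1 + 2 * nm.2) (2 * nm.2) z zb) +
        -1 * ((z * zb) ^ p *
          (gffOPECoeffSq p nm * hrBlock (2 * p + 2 * nm.1 + 2 * nm.2) (2 * nm.2) (1 - z) (1 - zb))) := by
    funext nm
    unfold crossF
    ring
  have hu : 0 < (z * zb) ^ p := Real.rpow_pos_of_pos (mul_pos hz.1 hzb.1) _
  have hv : 0 < ((1 - z) * (1 - zb)) ^ p := Real.rpow_pos_of_pos (mul_pos hz'.1 hzb'.1) _
  have hval : -(crossF p (-1) (fun _ _ => (1 : ℝ)) z zb) =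
      ((1 - z) * (1 - zb)) ^ p * meanFieldCorrelator p z zb +
        -1 * ((z * zb) ^ p * meanFieldCorrelator p (1 - z) (1 - zb)) := by
    unfold crossF meanFieldCorrelator
    rw [sub_sub_cancel, sub_sub_cancel]
    field_simp
    ring
  rw [hfun, hval]
  exact h

/-- **The generalised free field satisfies the single-correlator axioms** at `(Δ_σ, Δ_ε) = (p, 2p)` for every
`p > 1/2`. [cite: FitzpatrickKaplan2012, §2.2] -/
theorem gffData_satisfiesSigmaAxioms {p : ℝ} (hp : 1 / 2 < p) : (gffData p).SatisfiesSigmaAxioms := by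
  refine ⟨fun nm => (isAdmissible3D_of_lt (gff_unitarity hp nm.1 nm.2)).isConformalBlock3D_hrBlock,
    ⟨hp.le, by change 1 / 2 ≤ 2 * p; linarith, fun nm => (gff_unitarity hp nm.1 nm.2).le,
      fun nm => ?_⟩, ?_, ?_, ?_⟩
  · change Even (2 * nm.2)
    exact even_two_mul _
  · intro x hx0 hx1
    change Summable fun nm : ℕ × ℕ => Real.sqrt (gffOPECoeffSq p nm) ^ 2 *
      hrBlock (2 * p + 2 * nm.1 + 2 * nm.2) (2 * nm.2) x x
    simp only [Real.sq_sqrt (gffOPECoeffSq_pos hp _).le]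
    exact summable_gff_blocks_diag hp hx0 hx1
  · intro z zb hz hzb
    change HasSum (fun nm : ℕ × ℕ => Real.sqrt (gffOPECoeffSq p nm) ^ 2 *
      crossF p (-1) (hrBlock (2 * p + 2 * nm.1 + 2 * nm.2) (2 * nm.2)) z zb)
      (-(crossF p (-1) (fun _ _ => (1 : ℝ)) z zb))
    simp only [Real.sq_sqrt (gffOPECoeffSq_pos hp _).le]
    exact hasSum_gff_crossing hp hz hzb
  · intro nm h0 h3
    change 2 * nm.2 = 0 at h0
    change 2 * p + 2 * (nm.1 : ℝ) + 2 * (nm.2 : ℝ) < 3 at h3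
    change 2 * p + 2 * (nm.1 : ℝ) + 2 * (nm.2 : ℝ) = 2 * p
    have hm : nm.2 = 0 := by omega
    have hn : nm.1 = 0 := by
      by_contra hne
      have : (1 : ℝ) ≤ nm.1 := by exact_mod_cast Nat.one_le_iff_ne_zero.mpr hne
      linarith
    rw [hm, hn]
    simp

/-- **The single-correlator hypothesis class is non-empty in every column `Δ_σ = p > 1/2`**, with a member at
`(Δ_σ, Δ_ε) = (p, 2p)` (the generalised free line). [cite: FitzpatrickKaplan2012, §2.2] -/
theorem exists_satisfiesSigmaAxioms_gff {p : ℝ} (hp : 1 / 2 < p) :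
    ∃ D : SigmaEpsilonData, D.SatisfiesSigmaAxioms ∧ D.Δσ = p ∧ D.Δε = 2 * p :=
  ⟨gffData p, gffData_satisfiesSigmaAxioms hp, rfl, rfl⟩

/-- **No σ-excluded box contains a point of the generalised free line** `(p, 2p)`, `p > 1/2`. In particular no
single-correlator certificate (`SingleCorrelatorObligations` and every `PointCertificate…` schema) can exclude a
box meeting this line: their hypothesis class is realised on it (the mean-field line lies inside the
single-correlator allowed region, El-Showk et al. 2012 §5, Fig. 3). [cite: ElShowkEtAl2012, §5] -/
theorem SigmaBoxExcluded.gff_not_mem {Q : Set (ℝ × ℝ)} (h : SigmaBoxExcluded Q) {p : ℝ} (hp : 1 / 2 < p) :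
    (p, 2 * p) ∉ Q :=
  h (gffData p) (gffData_satisfiesSigmaAxioms hp)

/-- Contrapositive form: a box containing a point `(p, 2p)`, `p > 1/2`, is not σ-excluded. [cite: ElShowkEtAl2012, §5] -/
theorem not_sigmaBoxExcluded_of_gff_mem {Q : Set (ℝ × ℝ)} {p : ℝ} (hp : 1 / 2 < p) (hQ : (p, 2 * p) ∈ Q) :
    ¬ SigmaBoxExcluded Q :=
  fun h => h.gff_not_mem hp hQ

/-- **Sanity constraint on σ-enclosures**: if the window contains a point `(p, 2p)` of the generalised free
line (`p > 1/2`) then so does the region — no assembly of single-correlator certificates can carve the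
mean-field line out of its window. [cite: ElShowkEtAl2012, §5] -/
theorem SigmaIsingEnclosure.gff_mem {W R : Set (ℝ × ℝ)} (h : SigmaIsingEnclosure W R) {p : ℝ}
    (hp : 1 / 2 < p) (hW : (p, 2 * p) ∈ W) : (p, 2 * p) ∈ R :=
  h (gffData p) (gffData_satisfiesSigmaAxioms hp) hW

/-- The same for a discharged single-correlator obligation list. [cite: ElShowkEtAl2012, §5] -/
theorem SingleCorrelatorObligations.gff_not_mem {n : ℕ} {w z zb : Fin n → ℝ}
    (hz : ∀ k, z k ∈ Ioo (0 : ℝ) 1) (hzb : ∀ k, zb k ∈ Ioo (0 : ℝ) 1) {Q : Set (ℝ × ℝ)} {Δstar : ℝ}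
    (h : SingleCorrelatorObligations (pointFunctional w z zb) Q Δstar) {p : ℝ} (hp : 1 / 2 < p) :
    (p, 2 * p) ∉ Q :=
  (h.sigmaBoxExcluded hz hzb).gff_not_mem hp

end Literature.MathematicalPhysics.QuantumFieldTheory.ConformalBootstrap3D
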